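import Mathlib.Analysis.InnerProductSpace.PiL2
import Mathlib.Analysis.Complex.Basic
import Mathlib.Analysis.Meromorphic.Order
import Mathlib.Analysis.Analytic.Constructions
import Mathlib.Analysis.Calculus.Deriv.Inv
import Mathlib.Geometry.Manifold.Instances.Real
import Mathlib.Tactic

/-!
# The sphere at infinity `H∞` meets every flat `V`-leaf `{T_V = s}`, `s ≠ 0`, exactly once
(registered helper `helper_hinfLevelVCount` of line `cross-cap-laurent`, crux
`GromovRecognitionRelEnd`, item stmt-SmoothPoincare4-11009; the `V`-side mirror of the landed
`helper_vinfLevelHCount`, with the roles of the two complex factors `(p 0, p 1)` and `(p 2, p 3)`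
and of the charts `ηH`, `ηV` exchanged)

In the wedge cap `X` the cap charts `ηV, ηH, ηC : ℝ⁴ → X` live on the polydiscs
`D_V = {p 0 ^ 2 + p 1 ^ 2 < R₁⁻¹ ^ 2}`, `D_H = {p 2 ^ 2 + p 3 ^ 2 < R₁⁻¹ ^ 2}` and `D_C = D_V ∩ D_H`
(`(p 0, p 1)` is the first complex factor, `(p 2, p 3)` the second); off the axes they are glued to
`ι ∘ χ`, resp. to each other, by complex inversion of one factor:
`ηV (s, z₂) = ι (χ (1/s, z₂))` and `ηC (s, z₂) = ηH (1/s, z₂)` for `s ≠ 0`.  The wedge coordinate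
`T : X → ℂ` near `V∞` reads the first factor, `T (ηC p) = p 0 + i p 1` on `D_C`, and its level
sets inside `U_V = ηV '' D_V ∪ ηC '' D_C` are the flat leaves closed up by one corner point,
`{y ∈ U_V | T y = s} = {ηV (s, w) | w : ℂ} ∪ {ηC (s, 0)}` (`‖s‖ < R₁⁻¹`; this is the conclusion
of the neighbouring helper `helper_wedgeLevelSetV`, taken here as a hypothesis).  The sphere at
infinity `H∞` is the two-chart sphere `u z = ηH (z, 0, 0)`, `v 0 = ηC 0`, `v w = u w⁻¹` (`w ≠ 0`).

The intersection count of a two-chart sphere `(u, v)` with the leaf `{T = s}` is the sum of the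
meromorphic orders of `(T - s) ∘ u` over the parameters `z` with `u z ∈ U_V`, `T (u z) = s`, plus
the order of `(T - s) ∘ v` at `w = 0` when `v 0` lies on the leaf.  We prove that for `s ≠ 0`,
`‖s‖ < R₁⁻¹`, this count is exactly `1`:

* the chart at infinity does not contribute: `v 0 = ηC 0` and `T (ηC 0) = 0 ≠ s`;
* the affine index set is the singleton `{s⁻¹}`: a point `u z = ηH (z, 0, 0)` of the leaf is either
  `ηV (s, w')`, which lies in `range ι` because `s ≠ 0` (gluing clause for `ηV`) whereas the
  `H`-axis point `ηH (z, 0, 0)` does not, or the corner point `ηC (s, 0) = ηH (s⁻¹, 0, 0) = u s⁻¹`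
  (gluing clause for `ηC`), and then `z = s⁻¹` by injectivity of `ηH` on `D_H`;
* near `z₀ = s⁻¹` (where `‖z‖ > R₁`, so `‖z⁻¹‖ < R₁⁻¹`) the same gluing clause gives
  `u z = ηC (z⁻¹, 0, 0)`, hence `T (u z) - s = z⁻¹ - s`: by locality of the meromorphic order
  (`meromorphicOrderAt_congr`) and its invariance under the analytic change of variable `z ↦ z⁻¹`
  (`meromorphicOrderAt_comp_of_deriv_ne_zero`) the order at `s⁻¹` is the order of `w ↦ w - s` at
  `s`, namely `1` (`meromorphicOrderAt_id_sub_const`).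

Everything is proved from Mathlib's `finsum` and meromorphic-order API; no definition, no named
fact.

References: D. McDuff, D. Salamon, *J-holomorphic Curves and Symplectic Topology*, 2nd ed. (2012),
§2.6 and App. E (local intersection index as order of vanishing); M. Gromov, *Pseudo holomorphic
curves in symplectic manifolds*, Invent. Math. 82 (1985), 2.4.A₁′.
-/

-- the registered namespace `Summit.SmoothPoincare4.SmoothPoincare4.Theorems…` repeats a component
set_option linter.dupNamespace false

open scoped Manifold ContDiff Topology
open Set Filter

namespace Summit.SmoothPoincare4.SmoothPoincare4.Theorems.GromovRecognitionRelEnd.CrossCapLaurent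

/-- For `‖w‖ < R₁⁻¹`, the real coordinates of `w` lie in the disc of radius `R₁⁻¹`:
`w.re ^ 2 + w.im ^ 2 < R₁⁻¹ ^ 2`. -/
private lemma hinfLevelV_re_sq_add_im_sq_lt {R₁ : ℝ} {w : ℂ} (hw : ‖w‖ < R₁⁻¹) :
    w.re ^ 2 + w.im ^ 2 < R₁⁻¹ ^ 2 := by
  have h : w.re ^ 2 + w.im ^ 2 = ‖w‖ ^ 2 := by
    rw [← Complex.normSq_eq_norm_sq, Complex.normSq_apply]
    ring
  rw [h]
  exact pow_lt_pow_left₀ hw (norm_nonneg w) two_ne_zero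

/-- **The corner chart along the first factor is the affine chart of `H∞` read through `1/w`.**
For `0 < ‖w‖ < R₁⁻¹` the point `(w.re, w.im, 0, 0)` lies in the corner bidisc `D_C`, the gluing
clause `ηC (s, z₂) = ηH (1/s, z₂)` gives `ηC (w.re, w.im, 0, 0) = ηH (w⁻¹, 0, 0) = u w⁻¹`, and the
wedge coordinate reads `T (ηC (w.re, w.im, 0, 0)) = w`. -/
private lemma hinfLevelV_corner {X : Type} {R₁ : ℝ} {ηH ηC : EuclideanSpace ℝ (Fin 4) → X}
    {T : X → ℂ} {u : ℂ → X} (hR₁ : 0 < R₁)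
    (hglue : ∀ p : EuclideanSpace ℝ (Fin 4), p 0 ^ 2 + p 1 ^ 2 < R₁⁻¹ ^ 2 →
      p 2 ^ 2 + p 3 ^ 2 < R₁⁻¹ ^ 2 → (p 0 ≠ 0 ∨ p 1 ≠ 0) →
      ηC p = ηH (WithLp.toLp 2
        ![p 0 / (p 0 ^ 2 + p 1 ^ 2), -(p 1) / (p 0 ^ 2 + p 1 ^ 2), p 2, p 3]))
    (hT : ∀ p : EuclideanSpace ℝ (Fin 4), p 0 ^ 2 + p 1 ^ 2 < R₁⁻¹ ^ 2 →
      p 2 ^ 2 + p 3 ^ 2 < R₁⁻¹ ^ 2 → T (ηC p) = ⟨p 0, p 1⟩)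
    (hu : ∀ z : ℂ, u z = ηH (WithLp.toLp 2 ![z.re, z.im, 0, 0]))
    {w : ℂ} (hw0 : w ≠ 0) (hw : ‖w‖ < R₁⁻¹) :
    ηC (WithLp.toLp 2 ![w.re, w.im, 0, 0]) = u w⁻¹ ∧
      (WithLp.toLp 2 ![w.re, w.im, 0, 0] : EuclideanSpace ℝ (Fin 4)) ∈
        {p : EuclideanSpace ℝ (Fin 4) | p 0 ^ 2 + p 1 ^ 2 < R₁⁻¹ ^ 2 ∧
          p 2 ^ 2 + p 3 ^ 2 < R₁⁻¹ ^ 2} ∧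
      T (ηC (WithLp.toLp 2 ![w.re, w.im, 0, 0])) = w := by
  have hR : (0 : ℝ) < R₁⁻¹ ^ 2 := by positivity
  have hnorm : w.re ^ 2 + w.im ^ 2 < R₁⁻¹ ^ 2 := hinfLevelV_re_sq_add_im_sq_lt hw
  have hsq : Complex.normSq w = w.re ^ 2 + w.im ^ 2 := by
    rw [Complex.normSq_apply]
    ring
  set p : EuclideanSpace ℝ (Fin 4) := WithLp.toLp 2 ![w.re, w.im, 0, 0] with hp
  have hp0 : p 0 = w.re := by simp [hp]
  have hp1 : p 1 = w.im := by simp [hp]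
  have hp2 : p 2 = 0 := by simp [hp]
  have hp3 : p 3 = 0 := by simp [hp]
  have hpD : p 0 ^ 2 + p 1 ^ 2 < R₁⁻¹ ^ 2 := by
    rw [hp0, hp1]
    exact hnorm
  have hpC : p 2 ^ 2 + p 3 ^ 2 < R₁⁻¹ ^ 2 := by
    rw [hp2, hp3]
    simpa using hR
  have hp01 : p 0 ≠ 0 ∨ p 1 ≠ 0 := by
    rw [hp0, hp1]
    exact not_and_or.mp fun h => hw0 (Complex.ext (by simpa using h.1) (by simpa using h.2))
  refine ⟨?_, ⟨hpD, hpC⟩, ?_⟩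
  · rw [hglue p hpD hpC hp01, hu, hp0, hp1, hp2, hp3, Complex.inv_re, Complex.inv_im, hsq]
  · rw [hT p hpD hpC, hp0, hp1]

/-- **Registered helper `helper_hinfLevelVCount`** (line `cross-cap-laurent`, signature verbatim;
mirror of `helper_vinfLevelHCount`): for `s ≠ 0` with `‖s‖ < R₁⁻¹`, the sphere at infinity `H∞`
(`u z = ηH (z, 0, 0)`, `v 0 = ηC 0`, `v w = u w⁻¹`) meets the flat `V`-leaf `{T = s}` with
intersection count exactly `1`.  With `U_V = ηV '' D_V ∪ ηC '' D_C`,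
`{y ∈ U_V | T y = s} = {ηV (s, w)} ∪ {ηC (s, 0)}`, `T (ηC p) = p 0 + i p 1` on `D_C`, the gluing
clauses `ηV p = ι (χ ((p 0, p 1)⁻¹, p 2, p 3))`, `ηC p = ηH ((p 0, p 1)⁻¹, p 2, p 3)` off the axis
`p 0 = p 1 = 0`, injectivity of `ηH` on `D_H` and disjointness of the `H`-axis from `range ι`: the
chart at infinity does not contribute (`T (v 0) = T (ηC 0) = 0 ≠ s`), the affine index set is
`{s⁻¹}`, and there `(T - s) ∘ u` agrees near `s⁻¹` with `z ↦ z⁻¹ - s`, of meromorphic order `1`.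
See the file header. [folklore; cf. McDuff–Salamon 2012, §2.6] -/
theorem helper_hinfLevelVCount : ∀ (X : Type) [TopologicalSpace X]
    [ChartedSpace (EuclideanSpace ℝ (Fin 4)) X] [IsManifold (𝓡 4) ∞ X] (M : Type) (R₁ : ℝ)
    (χ : EuclideanSpace ℝ (Fin 4) → M) (ι : M → X) (ηH ηV ηC : EuclideanSpace ℝ (Fin 4) → X)
    (T : X → ℂ) (u v : ℂ → X), 0 < R₁ →
    Set.InjOn ηH {p : EuclideanSpace ℝ (Fin 4) | p 2 ^ 2 + p 3 ^ 2 < R₁⁻¹ ^ 2} →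
    (∀ p : EuclideanSpace ℝ (Fin 4), p 2 = 0 → p 3 = 0 → ηH p ∉ Set.range ι) →
    (∀ p : EuclideanSpace ℝ (Fin 4), p 0 ^ 2 + p 1 ^ 2 < R₁⁻¹ ^ 2 → (p 0 ≠ 0 ∨ p 1 ≠ 0) →
      ηV p = ι (χ (WithLp.toLp 2
        ![p 0 / (p 0 ^ 2 + p 1 ^ 2), -(p 1) / (p 0 ^ 2 + p 1 ^ 2), p 2, p 3]))) →
    (∀ p : EuclideanSpace ℝ (Fin 4), p 0 ^ 2 + p 1 ^ 2 < R₁⁻¹ ^ 2 → p 2 ^ 2 + p 3 ^ 2 < R₁⁻¹ ^ 2 →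
      (p 0 ≠ 0 ∨ p 1 ≠ 0) →
      ηC p = ηH (WithLp.toLp 2 ![p 0 / (p 0 ^ 2 + p 1 ^ 2), -(p 1) / (p 0 ^ 2 + p 1 ^ 2), p 2, p 3])) →
    (∀ p : EuclideanSpace ℝ (Fin 4), p 0 ^ 2 + p 1 ^ 2 < R₁⁻¹ ^ 2 → p 2 ^ 2 + p 3 ^ 2 < R₁⁻¹ ^ 2 →
      T (ηC p) = ⟨p 0, p 1⟩) →
    (∀ s : ℂ, ‖s‖ < R₁⁻¹ →
      {y : X | y ∈ (ηV '' {p : EuclideanSpace ℝ (Fin 4) | p 0 ^ 2 + p 1 ^ 2 < R₁⁻¹ ^ 2} ∪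
          ηC '' {p : EuclideanSpace ℝ (Fin 4) | p 0 ^ 2 + p 1 ^ 2 < R₁⁻¹ ^ 2 ∧
            p 2 ^ 2 + p 3 ^ 2 < R₁⁻¹ ^ 2}) ∧ T y = s} =
        Set.range (fun w : ℂ => ηV (WithLp.toLp 2 ![s.re, s.im, w.re, w.im])) ∪
          {ηC (WithLp.toLp 2 ![s.re, s.im, 0, 0])}) →
    (∀ z : ℂ, u z = ηH (WithLp.toLp 2 ![z.re, z.im, 0, 0])) → v 0 = ηC 0 →
    (∀ w : ℂ, w ≠ 0 → v w = u w⁻¹) →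
    ∀ s : ℂ, s ≠ 0 → ‖s‖ < R₁⁻¹ →
      (∑ᶠ z ∈ {z : ℂ | u z ∈ (ηV '' {p : EuclideanSpace ℝ (Fin 4) | p 0 ^ 2 + p 1 ^ 2 < R₁⁻¹ ^ 2} ∪
          ηC '' {p : EuclideanSpace ℝ (Fin 4) | p 0 ^ 2 + p 1 ^ 2 < R₁⁻¹ ^ 2 ∧
            p 2 ^ 2 + p 3 ^ 2 < R₁⁻¹ ^ 2}) ∧ (fun y => T y - s) (u z) = 0},
          (meromorphicOrderAt ((fun y => T y - s) ∘ u) z).untop₀) +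
        (∑ᶠ w ∈ {w : ℂ | w = 0 ∧ v w ∈ (ηV '' {p : EuclideanSpace ℝ (Fin 4) | p 0 ^ 2 + p 1 ^ 2 < R₁⁻¹ ^ 2} ∪
          ηC '' {p : EuclideanSpace ℝ (Fin 4) | p 0 ^ 2 + p 1 ^ 2 < R₁⁻¹ ^ 2 ∧
            p 2 ^ 2 + p 3 ^ 2 < R₁⁻¹ ^ 2}) ∧ (fun y => T y - s) (v w) = 0},
          (meromorphicOrderAt ((fun y => T y - s) ∘ v) w).untop₀) = 1 := by
  intro X _ _ _ M R₁ χ ι ηH ηV ηC T u v hR₁ hinj hHax hVglue hCglue hT hlevel hu hv0 _ s hs hsR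
  beta_reduce
  -- the two chart domains `D_V`, `D_C` (so that `U_V = ηV '' DV ∪ ηC '' DC`)
  set DV : Set (EuclideanSpace ℝ (Fin 4)) :=
    {p : EuclideanSpace ℝ (Fin 4) | p 0 ^ 2 + p 1 ^ 2 < R₁⁻¹ ^ 2} with hDV
  set DC : Set (EuclideanSpace ℝ (Fin 4)) :=
    {p : EuclideanSpace ℝ (Fin 4) | p 0 ^ 2 + p 1 ^ 2 < R₁⁻¹ ^ 2 ∧ p 2 ^ 2 + p 3 ^ 2 < R₁⁻¹ ^ 2}
    with hDC
  have hR : (0 : ℝ) < R₁⁻¹ ^ 2 := by positivity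
  have hss : s.re ^ 2 + s.im ^ 2 < R₁⁻¹ ^ 2 := hinfLevelV_re_sq_add_im_sq_lt hsR
  have hs01 : s.re ≠ 0 ∨ s.im ≠ 0 :=
    not_and_or.mp fun h => hs (Complex.ext (by simpa using h.1) (by simpa using h.2))
  -- (1) the chart at infinity does not contribute: `T (v 0) = T (ηC 0) = 0 ≠ s`
  have hD0 : (0 : EuclideanSpace ℝ (Fin 4)) ∈ DC := by
    refine ⟨?_, ?_⟩ <;> simpa using hR
  have hT0 : T (ηC 0) = 0 := by
    rw [hT 0 hD0.1 hD0.2]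
    exact Complex.ext (by simp) (by simp)
  have hS₂ : {w : ℂ | w = 0 ∧ v w ∈ (ηV '' DV ∪ ηC '' DC) ∧ T (v w) - s = 0} = ∅ := by
    refine Set.eq_empty_of_forall_notMem fun w hw => ?_
    obtain ⟨rfl, -, hw⟩ := hw
    rw [hv0, hT0, zero_sub, neg_eq_zero] at hw
    exact hs hw
  -- (2) the affine index set is the singleton `{s⁻¹}`
  obtain ⟨hCs, hsD, hTs⟩ := hinfLevelV_corner hR₁ hCglue hT hu hs hsR
  have hS₁ : {z : ℂ | u z ∈ (ηV '' DV ∪ ηC '' DC) ∧ T (u z) - s = 0} = {s⁻¹} := by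
    ext z
    simp only [Set.mem_setOf_eq, Set.mem_singleton_iff]
    constructor
    · rintro ⟨hzU, hzT⟩
      have hmem : u z ∈ Set.range (fun w : ℂ => ηV (WithLp.toLp 2 ![s.re, s.im, w.re, w.im])) ∪
          {ηC (WithLp.toLp 2 ![s.re, s.im, 0, 0])} := by
        rw [← hlevel s hsR]
        exact ⟨hzU, sub_eq_zero.mp hzT⟩
      rcases hmem with ⟨a, ha⟩ | h0
      · -- `u z = ηV (s, a)` lies in `range ι` (as `s ≠ 0`), but the `H`-axis misses `range ι`
        exfalso
        have hqD : (WithLp.toLp 2 ![s.re, s.im, a.re, a.im] : EuclideanSpace ℝ (Fin 4)) 0 ^ 2 +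
            (WithLp.toLp 2 ![s.re, s.im, a.re, a.im] : EuclideanSpace ℝ (Fin 4)) 1 ^ 2 <
              R₁⁻¹ ^ 2 := by
          simpa using hss
        have hq01 : (WithLp.toLp 2 ![s.re, s.im, a.re, a.im] : EuclideanSpace ℝ (Fin 4)) 0 ≠ 0 ∨
            (WithLp.toLp 2 ![s.re, s.im, a.re, a.im] : EuclideanSpace ℝ (Fin 4)) 1 ≠ 0 := by
          simpa using hs01
        have hι : u z ∈ Set.range ι := by
          rw [← ha]
          exact ⟨_, (hVglue _ hqD hq01).symm⟩
        rw [hu z] at hι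
        exact hHax _ (by simp) (by simp) hι
      · -- `u z = ηC (s, 0) = u s⁻¹`, and `ηH` is injective on `D_H`
        rw [Set.mem_singleton_iff, hCs, hu, hu] at h0
        have hpq := hinj (by simpa using hR) (by simpa using hR) h0
        apply Complex.ext
        · simpa using congrArg (fun q : EuclideanSpace ℝ (Fin 4) => q 0) hpq
        · simpa using congrArg (fun q : EuclideanSpace ℝ (Fin 4) => q 1) hpq
    · rintro rfl
      rw [← hCs, hTs, sub_self]
      exact ⟨Or.inr ⟨_, hsD, rfl⟩, rfl⟩
  -- (3) near `s⁻¹`, `(T - s) ∘ u` is `z ↦ z⁻¹ - s`, of meromorphic order `1` at `s⁻¹`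
  have hord : meromorphicOrderAt ((fun y => T y - s) ∘ u) s⁻¹ = 1 := by
    have hopen : IsOpen {z : ℂ | R₁ < ‖z‖} := isOpen_lt continuous_const continuous_norm
    have hmem : s⁻¹ ∈ {z : ℂ | R₁ < ‖z‖} := by
      rw [Set.mem_setOf_eq, norm_inv]
      exact (lt_inv_comm₀ hR₁ (norm_pos_iff.mpr hs)).mpr hsR
    have hev : ((fun y => T y - s) ∘ u) =ᶠ[𝓝 s⁻¹] ((fun w : ℂ => w - s) ∘ fun z : ℂ => z⁻¹) := by
      filter_upwards [hopen.mem_nhds hmem] with z hz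
      have hz0 : z ≠ 0 := norm_pos_iff.mp (hR₁.trans hz)
      have hzi : ‖z⁻¹‖ < R₁⁻¹ := by
        rw [norm_inv]
        exact inv_strictAnti₀ hR₁ hz
      obtain ⟨hCz, -, hTz⟩ := hinfLevelV_corner hR₁ hCglue hT hu (inv_ne_zero hz0) hzi
      rw [inv_inv] at hCz
      simp only [Function.comp_apply]
      rw [← hCz, hTz]
    have hg : AnalyticAt ℂ (fun z : ℂ => z⁻¹) s⁻¹ := analyticAt_inv (inv_ne_zero hs)
    have hg' : deriv (fun z : ℂ => z⁻¹) s⁻¹ ≠ 0 := by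
      rw [deriv_inv]
      exact neg_ne_zero.mpr (inv_ne_zero (pow_ne_zero 2 (inv_ne_zero hs)))
    have hcomp : meromorphicOrderAt ((fun w : ℂ => w - s) ∘ fun z : ℂ => z⁻¹) s⁻¹ =
        meromorphicOrderAt (fun w : ℂ => w - s) (s⁻¹)⁻¹ :=
      meromorphicOrderAt_comp_of_deriv_ne_zero hg hg'
    rw [meromorphicOrderAt_congr (hev.filter_mono nhdsWithin_le_nhds), hcomp, inv_inv]
    exact meromorphicOrderAt_id_sub_const
  -- assemble: `1 + 0 = 1`
  rw [hS₁, hS₂, finsum_mem_empty, finsum_mem_singleton, hord, add_zero]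
  rfl

end Summit.SmoothPoincare4.SmoothPoincare4.Theorems.GromovRecognitionRelEnd.CrossCapLaurent
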